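import Mathlib
import Summits.MatrixMultiplication.MatrixMultiplication.Theorems.SnSubsetDichotomyPolynomialSlackSpechtDimLower

/-!
# A cubic lower bound for the dimensions of the Specht modules below level two

Helper file for the LEVEL-TWO programme on the crux `SnSubsetDichotomy.PolynomialSlack`
(stmt-MatrixMultiplication-8306), one level below `…SpechtDimLower`: the Wedderburn blocks of
`ℂ[S_n]` other than the eight of level `≤ 2` — the partitions with a part `≥ n - 2` or with at least
`n - 2` parts — have dimension `f^μ ≫ n³`, so that in the dissected BCGPU identity they are negligible
up to volume `(n!)^{3/2}/n^{3/2-o(1)}`.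

Main result: `cubic_le_numStandardTableaux` — **for `n ≥ 40` and every partition `μ ⊢ n` all of
whose parts are `≤ n - 3` and which has at most `n - 3` parts, `n(n-1)(n-2) ≤ 24 f^μ`** (indeed
`C(n,3)/e ≤ f^μ`, `choose_three_div_exp_le_numStandardTableaux`). The sharp statement is Rasala's:
the minimum is `f^{(n-3,3)} = n(n-1)(n-5)/6` for `n` large [Rasala 1977, Thm. A]; the weak form here
is the self-starting strong induction of `…SpechtDimLower` (`sytBound_le_syt`) run one level deeper
(`sytBound₃_le_syt`), over Young diagrams whose first row and first column have at most `m - 3`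
cells, with the potential `min (C(m,3)/e, 2^{⌊(m-12)/2⌋})` (free for `m ≤ 12`): two corner rows
double the bound, a rectangle doubles it over two steps through its unique child, and a first row
(or, transposing, first column) of exactly `m - 3` cells is bounded directly by the tree's
long-first-row inequality `C(n,j) f^ν ≤ e f^μ` (`choose_mul_numStandardTableaux_le_exp_mul`, with
`j = 3`).

References: R. Rasala, *On the minimal degrees of characters of `S_n`*, J. Algebra 45 (1977)
132–181; G. James, *The Representation Theory of the Symmetric Groups*, LNM 682, §9 (branching).
-/

namespace Summit.MatrixMultiplication.MatrixMultiplication.Theorems.PolynomialSlack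

open Literature.NumberTheory.DiophantineGeometry Literature.RepresentationTheory.FiniteGroups

-- `Summit.<Summit>.<Problem>` is the tree's mandated summit-side namespace (CONVENTIONS §2); for
-- this single-conjunct summit the two coincide, so each declaration silences `dupNamespace`.
set_option linter.dupNamespace false

/-! ## The long-first-row bound: `a = |Y| - j`, `|Y| ≥ 3j` gives `C(|Y|,j)/e ≤ f^Y` -/

/-- **Long first rows, directly.** If the first row of `Y` has exactly `|Y| - j` cells, `j ≥ 1` and
`|Y| ≥ 3j`, then `C(|Y|, j)/e ≤ f^Y` (the tree's long-first-row inequality `C(n,j) f^ν ≤ e f^μ`,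
`ν` the body of `Y`, together with `1 ≤ f^ν`). [folklore] -/
theorem choose_div_exp_le_syt_of_rowLen_add {Y : YoungDiagram} {j : ℕ} (hj : 1 ≤ j)
    (h3 : 3 * j ≤ Y.cells.card) (ha : Y.rowLen 0 + j = Y.cells.card) :
    ((Y.cells.card).choose j : ℝ) / Real.exp 1 ≤ Nat.card (StdFilling Y.cells.card Y) := by
  obtain ⟨μ, hμY, -⟩ := exists_partition_youngDiagram_eq Y
  have hn : Y.cells.card ≠ 0 := by omega
  obtain ⟨ν, hs⟩ := exists_sortedParts_eq_sup_cons μ hn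
  -- the largest part is the first row
  have hcol : 1 ≤ Y.colLen 0 := one_le_colLen_of_card_pos (by omega)
  have hsup : μ.parts.sup = Y.rowLen 0 := by
    have h1 : Y.rowLens.head? = some μ.parts.sup := by
      have e : μ.youngDiagram.rowLens = μ.parts.sup :: ν.sortedParts := by
        rw [μ.rowLens_youngDiagram, hs]
      rw [hμY] at e
      rw [e]; rfl
    rw [head?_rowLens hcol] at h1
    exact (Option.some_injective _ h1).symm
  have hja : 2 * (Y.cells.card - μ.parts.sup) ≤ μ.parts.sup := by rw [hsup]; omega
  have key := choose_mul_numStandardTableaux_le_exp_mul hs hja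
  have eμ : (numStandardTableaux μ : ℝ) = Nat.card (StdFilling Y.cells.card Y) := by
    rw [numStandardTableaux_eq_card_stdFilling]
    -- `μ.youngDiagram = Y` and `|Y|` is the index
    have : Nat.card (StdFilling Y.cells.card μ.youngDiagram) =
        Nat.card (StdFilling Y.cells.card Y) := by
      rw [hμY]
    exact_mod_cast this
  rw [eμ] at key
  have hν : (1 : ℝ) ≤ numStandardTableaux ν := by exact_mod_cast numStandardTableaux_pos_holds ν
  have hchoose : (Y.cells.card).choose (Y.cells.card - μ.parts.sup) = (Y.cells.card).choose j := by
    rw [hsup, show Y.cells.card - Y.rowLen 0 = j by omega]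
  rw [hchoose] at key
  rw [div_le_iff₀ (Real.exp_pos 1)]
  have h0 : (0 : ℝ) ≤ (Y.cells.card).choose j := Nat.cast_nonneg _
  calc ((Y.cells.card).choose j : ℝ) = (Y.cells.card).choose j * 1 := (mul_one _).symm
    _ ≤ (Y.cells.card).choose j * numStandardTableaux ν := mul_le_mul_of_nonneg_left hν h0
    _ ≤ Real.exp 1 * Nat.card (StdFilling Y.cells.card Y) := key
    _ = Nat.card (StdFilling Y.cells.card Y) * Real.exp 1 := mul_comm _ _

/-! ## Binomial arithmetic for `C(·, 3)` -/

/-- `C(n+1, 3) = C(n, 2) + C(n, 3)`. [folklore] -/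
theorem choose_three_succ (n : ℕ) : (n + 1).choose 3 = n.choose 2 + n.choose 3 :=
  Nat.choose_succ_succ n 2

/-- `n ≤ C(n,3)` for `n ≥ 4`. [folklore] -/
theorem le_choose_three {n : ℕ} (hn : 4 ≤ n) : n ≤ n.choose 3 := by
  induction n, hn using Nat.le_induction with
  | base => decide
  | succ n hn ih =>
    rw [choose_three_succ]
    have := le_choose_two (show 3 ≤ n by omega)
    omega

/-- `C(n,2) ≤ C(n,3)` for `n ≥ 5`. [folklore] -/
theorem choose_two_le_choose_three {n : ℕ} (hn : 5 ≤ n) : n.choose 2 ≤ n.choose 3 := by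
  obtain ⟨k, rfl⟩ : ∃ k, n = k + 1 := ⟨n - 1, by omega⟩
  rw [choose_two_succ, choose_three_succ]
  have := le_choose_three (show 4 ≤ k by omega)
  omega

/-- `2n + 1 ≤ C(n,2)` for `n ≥ 6`. [folklore] -/
theorem two_mul_add_one_le_choose_two {n : ℕ} (hn : 6 ≤ n) : 2 * n + 1 ≤ n.choose 2 := by
  induction n, hn using Nat.le_induction with
  | base => decide
  | succ n hn ih =>
    rw [choose_two_succ]
    omega

/-- `n + 2·C(n,2) ≤ C(n,3)` for `n ≥ 9`. [folklore] -/
theorem add_two_mul_choose_two_le_choose_three {n : ℕ} (hn : 9 ≤ n) :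
    n + 2 * n.choose 2 ≤ n.choose 3 := by
  induction n, hn using Nat.le_induction with
  | base => decide
  | succ n hn ih =>
    rw [choose_two_succ, choose_three_succ]
    have := two_mul_add_one_le_choose_two (show 6 ≤ n by omega)
    omega

/-- `C(m,3) ≤ 2·C(m-1,3)` for `m ≥ 6`. [folklore] -/
theorem choose_three_le_two_mul_pred {m : ℕ} (hm : 6 ≤ m) : m.choose 3 ≤ 2 * (m - 1).choose 3 := by
  obtain ⟨n, rfl⟩ : ∃ n, m = n + 1 := ⟨m - 1, by omega⟩
  rw [choose_three_succ, Nat.add_sub_cancel]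
  have := choose_two_le_choose_three (show 5 ≤ n by omega)
  omega

/-- `C(m,3) ≤ 2·C(m-2,3)` for `m ≥ 11`. [folklore] -/
theorem choose_three_le_two_mul_pred_pred {m : ℕ} (hm : 11 ≤ m) :
    m.choose 3 ≤ 2 * (m - 2).choose 3 := by
  obtain ⟨n, rfl⟩ : ∃ n, m = n + 2 := ⟨m - 2, by omega⟩
  rw [show n + 2 = (n + 1) + 1 by ring, choose_three_succ, choose_three_succ, choose_two_succ,
    show n + 1 + 1 - 2 = n by omega]
  have := add_two_mul_choose_two_le_choose_three (show 9 ≤ n by omega)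
  omega

/-- `n(n-1)(n-2) = 6·C(n,3)`. [folklore] -/
theorem mul_pred_mul_pred_pred_eq_six_mul_choose_three (n : ℕ) :
    n * (n - 1) * (n - 2) = 6 * n.choose 3 := by
  have h1 := Nat.descFactorial_eq_factorial_mul_choose n 3
  rw [show Nat.factorial 3 = 6 from rfl] at h1
  rw [← h1]
  simp only [Nat.descFactorial_succ, Nat.descFactorial_zero, Nat.sub_zero, mul_one]
  ring

/-! ## The potential of the induction -/

/-- The potential is at most `1` for `m ≤ 12` (free base of the induction). [folklore] -/
theorem sytBound₃_le_one {m : ℕ} (hm : m ≤ 12) :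
    min ((Nat.choose m 3 : ℝ) / Real.exp 1) ((2 : ℝ) ^ ((m - 12) / 2)) ≤ 1 := by
  rw [show (m - 12) / 2 = 0 by omega, pow_zero]
  exact min_le_right _ _

/-- The potential is at most its cubic component. [folklore] -/
theorem sytBound₃_le_choose (m : ℕ) :
    min ((Nat.choose m 3 : ℝ) / Real.exp 1) ((2 : ℝ) ^ ((m - 12) / 2)) ≤
      (m.choose 3 : ℝ) / Real.exp 1 :=
  min_le_left _ _

/-- One-step doubling of the cubic potential for `m ≥ 13`. [folklore] -/
theorem sytBound₃_le_two_mul_pred {m : ℕ} (hm : 13 ≤ m) :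
    min ((Nat.choose m 3 : ℝ) / Real.exp 1) ((2 : ℝ) ^ ((m - 12) / 2)) ≤
      2 * min ((Nat.choose (m - 1) 3 : ℝ) / Real.exp 1) ((2 : ℝ) ^ (((m - 1) - 12) / 2)) := by
  have he : 0 < Real.exp 1 := Real.exp_pos 1
  rw [mul_min_of_nonneg _ _ (by norm_num : (0 : ℝ) ≤ 2)]
  refine le_min (le_trans (min_le_left _ _) ?_) (le_trans (min_le_right _ _) ?_)
  · rw [mul_div_assoc', div_le_div_iff_of_pos_right he]
    exact_mod_cast choose_three_le_two_mul_pred (by omega)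
  · rw [← pow_succ']
    exact pow_le_pow_right₀ (by norm_num) (by omega)

/-- Two-step doubling of the cubic potential for `m ≥ 13`. [folklore] -/
theorem sytBound₃_le_two_mul_pred_pred {m : ℕ} (hm : 13 ≤ m) :
    min ((Nat.choose m 3 : ℝ) / Real.exp 1) ((2 : ℝ) ^ ((m - 12) / 2)) ≤
      2 * min ((Nat.choose (m - 2) 3 : ℝ) / Real.exp 1) ((2 : ℝ) ^ (((m - 2) - 12) / 2)) := by
  have he : 0 < Real.exp 1 := Real.exp_pos 1
  rw [mul_min_of_nonneg _ _ (by norm_num : (0 : ℝ) ≤ 2)]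
  refine le_min (le_trans (min_le_left _ _) ?_) (le_trans (min_le_right _ _) ?_)
  · rw [mul_div_assoc', div_le_div_iff_of_pos_right he]
    exact_mod_cast choose_three_le_two_mul_pred_pred (by omega)
  · rw [← pow_succ']
    exact pow_le_pow_right₀ (by norm_num) (by omega)

/-- For `m ≥ 40` the potential is the cubic `C(m,3)/e`. [folklore] -/
theorem sytBound₃_eq_of_le {m : ℕ} (hm : 40 ≤ m) :
    min ((Nat.choose m 3 : ℝ) / Real.exp 1) ((2 : ℝ) ^ ((m - 12) / 2)) =
      (m.choose 3 : ℝ) / Real.exp 1 := by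
  refine min_eq_left ?_
  -- `C(m,3) ≤ C(2k+13, 3) ≤ 2^k` with `k = ⌊(m-12)/2⌋ ≥ 14`
  have key : ∀ k, 14 ≤ k → (2 * k + 13).choose 3 ≤ 2 ^ k := by
    intro k hk
    induction k, hk using Nat.le_induction with
    | base => decide
    | succ k hk ih =>
      have h1 := choose_three_le_two_mul_pred_pred (show 11 ≤ 2 * (k + 1) + 13 by omega)
      rw [show 2 * (k + 1) + 13 - 2 = 2 * k + 13 by omega] at h1
      rw [pow_succ]
      omega
  set k := (m - 12) / 2 with hk
  have hk14 : 14 ≤ k := by omega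
  have hmk : m ≤ 2 * k + 13 := by omega
  have h3 : (m.choose 3 : ℝ) ≤ 2 ^ k := by
    have := (Nat.choose_le_choose 3 hmk).trans (key k hk14)
    exact_mod_cast this
  have he1 : 1 ≤ Real.exp 1 := Real.one_le_exp (by norm_num)
  calc (m.choose 3 : ℝ) / Real.exp 1 ≤ (m.choose 3 : ℝ) / 1 :=
        div_le_div_of_nonneg_left (Nat.cast_nonneg _) one_pos he1
    _ = m.choose 3 := div_one _
    _ ≤ 2 ^ k := h3

/-! ## The induction -/

/-- Arithmetic of rectangles: `ab ≥ 13`, `b ≥ 2` force `a + 5 ≤ ab`. [folklore] -/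
theorem add_five_le_mul {a b : ℕ} (hb : 2 ≤ b) (hab : 13 ≤ a * b) : a + 5 ≤ a * b := by
  rcases (show b = 2 ∨ 3 ≤ b by omega) with rfl | hb3
  · omega
  · have h3 := Nat.mul_le_mul_left a hb3
    rcases (show a ≤ 2 ∨ 3 ≤ a by omega) with ha | ha
    · interval_cases a <;> omega
    · omega

/-- Removing a corner from a diagram whose first row and first column both have at most `|Y| - 4`
cells leaves a diagram whose first row and column have at most `|Y ⊖ c| - 3` cells. [folklore] -/
theorem nonexc_removeAbove₃ {Y : YoungDiagram} {r n : ℕ} (h : (Y.rowLen (r + 1) < Y.rowLen r))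
    (hY : Y.cells.card = n + 1) (ha : Y.rowLen 0 + 4 ≤ n + 1) (hb : Y.colLen 0 + 4 ≤ n + 1) :
    (Y.removeAbove ((r, Y.rowLen r - 1))).cells.card = n ∧
      (Y.removeAbove ((r, Y.rowLen r - 1))).rowLen 0 + 3 ≤ n ∧
      (Y.removeAbove ((r, Y.rowLen r - 1))).colLen 0 + 3 ≤ n := by
  refine ⟨card_removeAbove_cornerCell h hY, ?_, ?_⟩
  · have := rowLen_le_of_le (removeAbove_le Y ((r, Y.rowLen r - 1))) 0; omega
  · have := colLen_le_of_le (removeAbove_le Y ((r, Y.rowLen r - 1))) 0; omega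

/-- **The cubic lower bound on Young diagrams.** For every Young diagram `Y` with `|Y| = m` whose
first row and first column have at most `m - 3` cells,
`min (C(m,3)/e, 2^{⌊(m-12)/2⌋}) ≤ f^Y`. Strong induction on `m`: `m ≤ 12` is free (`f ≥ 1`); a first
row (or, transposing, first column) of exactly `m - 3` cells is the long-first-row bound with
`j = 3`; otherwise two corner rows give `2·bound(m-1)`, and a rectangle gives `2·bound(m-2)` through
its unique child. [folklore] -/
theorem sytBound₃_le_syt : ∀ (m : ℕ) (Y : YoungDiagram), Y.cells.card = m →
    Y.rowLen 0 + 3 ≤ m → Y.colLen 0 + 3 ≤ m →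
      min ((Nat.choose m 3 : ℝ) / Real.exp 1) ((2 : ℝ) ^ ((m - 12) / 2)) ≤
        Nat.card (StdFilling Y.cells.card Y) := by
  intro m
  induction m using Nat.strong_induction_on with
  | _ m ih =>
    intro Y hY ha hb
    -- small sizes are free
    by_cases hm : m ≤ 12
    · exact (sytBound₃_le_one hm).trans (by exact_mod_cast one_le_card_stdFilling Y)
    have hm13 : 13 ≤ m := by omega
    -- case A: first row of length `m - 3`
    by_cases hA : Y.rowLen 0 + 3 = m
    · refine (sytBound₃_le_choose m).trans ?_
      rw [← hY] at hA ⊢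
      exact choose_div_exp_le_syt_of_rowLen_add (by norm_num) (by omega) hA
    -- case B: first column of length `m - 3` (transpose)
    by_cases hB : Y.colLen 0 + 3 = m
    · refine (sytBound₃_le_choose m).trans ?_
      rw [← card_stdFilling_transpose']
      have hY' : Y.transpose.cells.card = m := by rw [YoungDiagram.card_transpose, hY]
      have hA' : Y.transpose.rowLen 0 + 3 = Y.transpose.cells.card := by
        rw [YoungDiagram.rowLen_transpose, hY']; exact hB
      rw [← hY']
      exact choose_div_exp_le_syt_of_rowLen_add (by norm_num) (by omega) hA'
    -- case C: both first row and first column have at most `m - 4` cells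
    have ha4 : Y.rowLen 0 + 4 ≤ m := by omega
    have hb4 : Y.colLen 0 + 4 ≤ m := by omega
    obtain ⟨n, rfl⟩ : ∃ n, m = n + 1 := ⟨m - 1, by omega⟩
    have hcol : 1 ≤ Y.colLen 0 := one_le_colLen_of_card_pos (by omega)
    have hlast : (Y.rowLen (Y.colLen 0 - 1 + 1) < Y.rowLen (Y.colLen 0 - 1)) := isCornerRow_last hcol
    by_cases hex : ∃ r, r + 1 < Y.colLen 0 ∧ (Y.rowLen (r + 1) < Y.rowLen r)
    · -- two distinct corner rows
      obtain ⟨r, hr, hcr⟩ := hex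
      obtain ⟨c1, a1, b1⟩ := nonexc_removeAbove₃ hcr hY ha4 hb4
      obtain ⟨c2, a2, b2⟩ := nonexc_removeAbove₃ hlast hY ha4 hb4
      have i1 := ih n (by omega) _ c1 a1 b1
      have i2 := ih n (by omega) _ c2 a2 b2
      have hsum := add_le_syt_of_isCornerRow hcr hlast (by omega)
      have hsumR : (Nat.card (StdFilling (Y.removeAbove ((r, Y.rowLen r - 1))).cells.card
            (Y.removeAbove ((r, Y.rowLen r - 1)))) : ℝ) +
          Nat.card (StdFilling
            (Y.removeAbove ((Y.colLen 0 - 1, Y.rowLen (Y.colLen 0 - 1) - 1))).cells.card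
            (Y.removeAbove ((Y.colLen 0 - 1, Y.rowLen (Y.colLen 0 - 1) - 1)))) ≤
          Nat.card (StdFilling Y.cells.card Y) := by exact_mod_cast hsum
      have hrec := sytBound₃_le_two_mul_pred hm13
      rw [Nat.add_sub_cancel] at hrec
      linarith
    · -- a rectangle `a × b`
      push Not at hex
      set a := Y.rowLen 0 with ha_def
      set b := Y.colLen 0 with hb_def
      have hrect : ∀ r, r < b → Y.rowLen r = a := fun r hr =>
        rowLen_eq_rowLen_zero_of_no_corner (fun r hr => not_lt.2 (hex r hr)) hr
      have hab : n + 1 = a * b := hY ▸ card_eq_mul_of_rect hrect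
      have ha2 : 2 ≤ a := by
        by_contra hlt
        have := card_eq_colLen_of_rowLen_le_one (Y := Y) (by omega)
        omega
      have hb2 : 2 ≤ b := by
        by_contra hlt
        have := card_eq_rowLen_of_colLen_le_one (Y := Y) (by omega)
        omega
      have ha5 : a + 5 ≤ n + 1 := hab ▸ add_five_le_mul hb2 (by omega)
      have hb5 : b + 5 ≤ n + 1 := by
        rw [hab, mul_comm]; exact add_five_le_mul ha2 (by rw [mul_comm]; omega)
      -- the unique child `Z`
      set Z := Y.removeAbove ((b - 1, Y.rowLen (b - 1) - 1)) with hZ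
      obtain ⟨m', rfl⟩ : ∃ m', n = m' + 1 := ⟨n - 1, by omega⟩
      have cZ : Z.cells.card = m' + 1 := card_removeAbove_cornerCell hlast hY
      have hZrow : ∀ r, r < b - 1 → Z.rowLen r = a := fun r hr => by
        rw [hZ, rowLen_removeAbove_cornerCell_of_ne hlast (by omega)]; exact hrect r (by omega)
      have hZlast : Z.rowLen (b - 1) = a - 1 := by
        rw [hZ, rowLen_removeAbove_cornerCell_self hlast, hrect (b - 1) (by omega)]
      have hZb : Z.rowLen b = 0 := by
        rw [hZ, rowLen_removeAbove_cornerCell_of_ne hlast (by omega)]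
        exact VershikKerov.rowLen_eq_zero _ le_rfl
      have hc1 : (Z.rowLen (b - 1 + 1) < Z.rowLen (b - 1)) := by
        rw [show b - 1 + 1 = b by omega, hZb, hZlast]; omega
      have hc2 : (Z.rowLen (b - 2 + 1) < Z.rowLen (b - 2)) := by
        rw [show b - 2 + 1 = b - 1 by omega, hZlast, hZrow (b - 2) (by omega)]
        omega
      have haZ : Z.rowLen 0 + 4 ≤ m' + 1 := by
        have := rowLen_le_of_le (removeAbove_le Y ((b - 1, Y.rowLen (b - 1) - 1))) 0
        rw [← hZ] at this; omega
      have hbZ : Z.colLen 0 + 4 ≤ m' + 1 := by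
        have := colLen_le_of_le (removeAbove_le Y ((b - 1, Y.rowLen (b - 1) - 1))) 0
        rw [← hZ] at this; omega
      obtain ⟨c1, a1, b1⟩ := nonexc_removeAbove₃ hc1 cZ haZ hbZ
      obtain ⟨c2, a2, b2⟩ := nonexc_removeAbove₃ hc2 cZ haZ hbZ
      have i1 := ih m' (by omega) _ c1 a1 b1
      have i2 := ih m' (by omega) _ c2 a2 b2
      have hsum := add_le_syt_of_isCornerRow hc1 hc2 (by omega)
      have hsumR : (Nat.card (StdFilling (Z.removeAbove ((b - 1, Z.rowLen (b - 1) - 1))).cells.card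
            (Z.removeAbove ((b - 1, Z.rowLen (b - 1) - 1)))) : ℝ) +
          Nat.card (StdFilling (Z.removeAbove ((b - 2, Z.rowLen (b - 2) - 1))).cells.card
            (Z.removeAbove ((b - 2, Z.rowLen (b - 2) - 1)))) ≤
          Nat.card (StdFilling Z.cells.card Z) := by exact_mod_cast hsum
      have hZY : (Nat.card (StdFilling Z.cells.card Z) : ℝ) ≤ Nat.card (StdFilling Y.cells.card Y) := by
        exact_mod_cast le_syt_of_isCornerRow hlast
      have hrec := sytBound₃_le_two_mul_pred_pred hm13
      rw [show m' + 1 + 1 - 2 = m' by omega] at hrec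
      linarith

/-! ## The bound for partitions -/

/-- **Cubic lower bound for Specht dimensions (weak Rasala, level two).** For `n ≥ 40` and a
partition `μ ⊢ n` all of whose parts are at most `n - 3` and which has at most `n - 3` parts — i.e.
`μ` is none of the eight shapes of level `≤ 2` — the number of standard Young tableaux satisfies
`C(n,3)/e ≤ f^μ`. (Rasala 1977 gives the sharp minimum `n(n-1)(n-5)/6`.) [folklore] -/
theorem choose_three_div_exp_le_numStandardTableaux {n : ℕ} (hn : 40 ≤ n) (μ : Nat.Partition n)
    (hrow : ∀ a ∈ μ.parts, a + 3 ≤ n) (hcol : μ.parts.card + 3 ≤ n) :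
    (n.choose 3 : ℝ) / Real.exp 1 ≤ numStandardTableaux μ := by
  rw [numStandardTableaux_eq_card_stdFilling', ← sytBound₃_eq_of_le hn]
  refine sytBound₃_le_syt n μ.youngDiagram μ.card_cells_youngDiagram ?_ ?_
  · rcases rowLen_zero_mem_parts_or μ with h | h
    · exact hrow _ h
    · omega
  · rw [colLen_zero_youngDiagram]; exact hcol

/-- **Cubic lower bound for Specht dimensions, integer form**: for `n ≥ 40` and a partition `μ ⊢ n`
all of whose parts are at most `n - 3` and which has at most `n - 3` parts,
`n(n-1)(n-2) ≤ 24 f^μ`. [folklore] -/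
theorem cubic_le_numStandardTableaux {n : ℕ} (hn : 40 ≤ n) (μ : Nat.Partition n)
    (hrow : ∀ a ∈ μ.parts, a + 3 ≤ n) (hcol : μ.parts.card + 3 ≤ n) :
    n * (n - 1) * (n - 2) ≤ 24 * numStandardTableaux μ := by
  have h := choose_three_div_exp_le_numStandardTableaux hn μ hrow hcol
  rw [div_le_iff₀ (Real.exp_pos 1)] at h
  have he : Real.exp 1 < 3 := lt_trans Real.exp_one_lt_d9 (by norm_num)
  have hf : (0 : ℝ) ≤ numStandardTableaux μ := Nat.cast_nonneg _
  have h3 : ((6 * n.choose 3 : ℕ) : ℝ) ≤ 24 * numStandardTableaux μ := by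
    push_cast
    nlinarith [mul_nonneg hf (show (0 : ℝ) ≤ 3 - Real.exp 1 by linarith)]
  rw [mul_pred_mul_pred_pred_eq_six_mul_choose_three]
  exact_mod_cast h3

end Summit.MatrixMultiplication.MatrixMultiplication.Theorems.PolynomialSlack
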